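import Summits.QuantumFields.YangMills.Theorems.BalabanUVNodesN15BackgroundMatrixByPartsTwoSidedLettersNode
import Summits.QuantumFields.YangMills.Theorems.BalabanUVNodesN15BackgroundV1Species
import HarnessLib

/-!
# THE FIFTEEN COEFFICIENT LETTERS `TwoSidedLetters` OF THE TWO-SIDED BY-PARTS LAYER FOR THE COEFFICIENTS OF BAŁABAN's OWN FIRST-ORDER SPECIES `V′₁(A)` (3.52) —
# `c = ad_W + Σ_μ[F′(ad A⁺_μ) + F′(ad A⁻_μ)]`, `a⁺_μ = ad A⁺_μ + ηF′(ad A⁺_μ)`, `a⁻_μ = ad A⁻_μ − ηF′(ad A⁻_μ)` (g2 V1a `v1coefC`, `v1coefA`) — FROM THE LETTERS OF THE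
# FIELD TRIPLES, AND FROM THE LETTERS OF ONE FINE AND ONE COARSE GAUGE FIELD (dag-n15-c g9, FILE 25; Track-A node N15 = NE2, s1 «background-layer OPERATOR ingredient»)

`--kind proof --supports stmt-QuantumFields-20544 --as helper` (K3⁷; count-neutral; theorems only).  Imports BY NAME this seat's FILE 24 `…TwoSidedLettersNode` (`TwoSidedLetters`), g2
V1a∕V1b `…BackgroundV1Coefficients` ∕ `…BackgroundV1Species` (`v1coefC`, `v1coefA`, `v1fieldsOfGauge`, `rowSum_v1coefC_le`, `rowSum_v1coefA_le`, `rowFit_v1coefC`, `rowFit_v1coefA`,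
`rowFit_ad_le`, `rowFit_Phi2ad_le`, `rowSum_smulPhi2ad_le`), n15-b parts 13a∕16∕17 (`coordMat`, `coordMat_sub`, `basisConst`, `rowDiff_ad`, `adCLM_sub`), [Lit] `adCLM_smul`; nothing in the
tree is modified.

WHAT.  §1 small algebra (`fgradMat_entry`, `coordMat_smul`, `smul_coordMat_ad_sub`, `v1coefA_inl ∕ _inr`) and the four NEW letter mechanisms of the by-parts layer for the species
`ad + ηF′(ad ·)`: GRADIENT ROWS (`row_fgrad_ad_le`: the difference quotient of the LINEAR species is the species of the difference quotient, `≤ 2κ_e r` from the one-step letter `rη`;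
`row_fgrad_Phi2ad_le`: `η⁻¹·η·(fit of F′(ad ·) over one step) ≤ 6eκ_e rη`), DERIVATIVE FITS (`row_dfit_ad_le`: `≤ 2κ_e·rθ` from the fit of the difference QUOTIENTS; `row_dfit_Phi2ad_le`: two
plain fits, `≤ 12eκ_e rθ`).  §2 ★★ `twoSidedLetters_of_triples`: for two field triples `U′ = (P′, Q′, W′)` (spacing `η′`, shifts `s′`) and `U = (P, Q, W)` (spacing `η ≥ η′`, shifts `s`,
`η ≤ min(1, θ)`) with sups `≤ r` (`2r ≤ 1`), fits `≤ rθ`, one-step letters `‖P_μ − P_μ∘s_μ⁻¹‖, ‖Q_μ − Q_μ∘s_μ⁻¹‖ ≤ rη` (both spacings), translated fits of `P∘s⁻¹` and `Q∘s` and the two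
derivative fits (`≤ rθ`): `TwoSidedLetters J ι π s s′ η⁻¹ η′⁻¹ (14e(1+|J|)κ_e·r) θ (c′, a′) (c, a)`.  §3 ★★ `twoSidedLetters_of_gauge`: the same for the GAUGE triples
`v1fieldsOfGauge s′ η′ A′`, `v1fieldsOfGauge s η A` of one fine and one COARSE gauge field from five gauge letters (sups, one-step letters along the own direction, fit, translated fit,
derivative fit) at `r̂ = (1+|J|)r`.

WHY.  FILE 24's node theorem ★★★ `ne2PlusOperator_twoSided_of_letters` turns these letters (plus the `U ≡ 1` layer) into `NE2PlusOperator c₃₅` BY NAME with the coarse coefficients READ from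
the coarse gauge field — Bałaban's (3.52) with both bond orientations, entry 2 by parts, no mixed piece.

HONEST FRAMING.  Shapes of (3.52) in the `U ≡ 1` background, `𝔤 ↦ 𝔄` with coordinates `e`, crude constants; nothing about `G(U)` asserted; NE2⁺ NOT PRINTED; N15 not discharged; nothing
continuum ∕ OS ∕ mass-gap ∕ Clay.
-/

noncomputable section

open scoped BigOperators
open Finset

namespace Summit.QuantumFields.YangMills.BalabanUVNodes.N15.BackgroundLayer

open Literature.MathematicalPhysics.QuantumFieldTheory.Balaban1983to89.Beta.AveragingCorrectionJets (adCLM adCLM_smul)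
open Summit.QuantumFields.YangMills.BalabanUVNodes.N15.MatrixSpecies (Phi2 coordMat coordMat_sub basisConst basisConst_nonneg rowDiff_ad adCLM_sub)

/-! ## §1 Small algebra and the four new letter mechanisms -/

section Mechanisms

variable {X X' J ι : Type} [Fintype ι] [DecidableEq ι] {𝔄 : Type} [NormedRing 𝔄] [NormedAlgebra ℝ 𝔄] [CompleteSpace 𝔄] (e : 𝔄 ≃L[ℝ] (ι → ℝ))

omit [Fintype ι] [DecidableEq ι] in
/-- Entries of the difference quotient of a matrix field. [folklore] -/
theorem fgradMat_entry (n : ℝ) (τ : X ≃ X) (A : X → Matrix ι ι ℝ) (x : X) (i j : ι) : fgradMat n τ A x i j = n * (A (τ x) i j - A x i j) := by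
  simp only [fgradMat, Matrix.smul_apply, Matrix.sub_apply, smul_eq_mul]

omit [CompleteSpace 𝔄] in
/-- Coordinates are linear in the operator: `coordMat e (c•T) = c•coordMat e T`. [folklore] -/
theorem coordMat_smul (c : ℝ) (T : 𝔄 →L[ℝ] 𝔄) : coordMat e (c • T) = c • coordMat e T := by
  ext i j
  simp [coordMat, LinearMap.toMatrix'_apply]

omit [CompleteSpace 𝔄] in
/-- The difference quotient of the LINEAR species is the species of the difference quotient: `n•(coordMat(ad a) − coordMat(ad b)) = coordMat(ad (n•(a − b)))`. [folklore] -/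
theorem smul_coordMat_ad_sub (n : ℝ) (a b : 𝔄) : n • (coordMat e (adCLM ℝ a) - coordMat e (adCLM ℝ b)) = coordMat e (adCLM ℝ (n • (a - b))) := by
  rw [adCLM_smul, coordMat_smul, ← adCLM_sub, coordMat_sub]

variable [Fintype J]

omit [Fintype J] [CompleteSpace 𝔄] in
/-- The forward components of `v1coefA`. [folklore] -/
theorem v1coefA_inl (η : ℝ) (U : (J → X → 𝔄) × (J → X → 𝔄) × (X → 𝔄)) (μ : J) (x : X) :
    v1coefA e η U (Sum.inl μ) x = coordMat e (adCLM ℝ (U.1 μ x)) + η • coordMat e (Phi2 η (adCLM ℝ (U.1 μ x))) := rfl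

omit [Fintype J] [CompleteSpace 𝔄] in
/-- The backward components of `v1coefA`. [folklore] -/
theorem v1coefA_inr (η : ℝ) (U : (J → X → 𝔄) × (J → X → 𝔄) × (X → 𝔄)) (μ : J) (x : X) :
    v1coefA e η U (Sum.inr μ) x = coordMat e (adCLM ℝ (U.2.1 μ x)) - η • coordMat e (Phi2 η (adCLM ℝ (U.2.1 μ x))) := rfl

omit [Fintype J] [CompleteSpace 𝔄] in
/-- GRADIENT ROW OF THE LINEAR SPECIES: `Σ_j |η⁻¹(coordMat(ad a(τx)) − coordMat(ad a(x)))_{ij}| ≤ κ_e·2r` from the one-step letter `‖a − a∘τ⁻¹‖ ≤ rη` (part 17 `rowDiff_ad` at `τx`).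
[folklore] -/
theorem row_fgrad_ad_le {η r : ℝ} (hη : 0 < η) (τ : X ≃ X) {a : X → 𝔄} (hδ : ∀ x, ‖a x - a (τ.symm x)‖ ≤ r * η) (x : X) (i : ι) :
    ∑ j, |η⁻¹ * (coordMat e (adCLM ℝ (a (τ x))) i j - coordMat e (adCLM ℝ (a x)) i j)| ≤ basisConst e * (2 * r) := by
  have h := rowDiff_ad e τ hη (G := r) (fun x' => (hδ x').trans (le_of_eq (mul_comm _ _))) (τ x) i
  simpa only [Equiv.symm_apply_apply] using h

omit [Fintype J] in
/-- GRADIENT ROW OF THE `F′`-PART: `Σ_j |η⁻¹(η·P₂(τx) − η·P₂(x))_{ij}| ≤ κ_e·6e·rη` (`P₂ = coordMat F′(ad a)`; one-step fit of `F′(ad ·)`, V1a `rowFit_Phi2ad_le` with `π = id`, `θ = η`).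
[folklore] -/
theorem row_fgrad_Phi2ad_le {η r : ℝ} (hη : 0 < η) (hη1 : η ≤ 1) (hr : 0 ≤ r) (hr2 : 2 * r ≤ 1) (τ : X ≃ X) {a : X → 𝔄} (ha : ∀ x, ‖a x‖ ≤ r)
    (hδ : ∀ x, ‖a x - a (τ.symm x)‖ ≤ r * η) (x : X) (i : ι) :
    ∑ j, |η⁻¹ * (η * coordMat e (Phi2 η (adCLM ℝ (a (τ x)))) i j - η * coordMat e (Phi2 η (adCLM ℝ (a x))) i j)| ≤ basisConst e * (6 * Real.exp 1 * (r * η)) := by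
  have hfit : ∀ x, ‖a (τ x) - a (id x)‖ ≤ r * η := fun x => by simpa only [id, Equiv.symm_apply_apply] using hδ (τ x)
  have h := rowFit_Phi2ad_le e (id : X → X) hr hr2 hη.le le_rfl hη1 le_rfl (a' := fun x => a (τ x)) (a := a) (fun x => ha _) ha hfit x i
  have hη0 : η ≠ 0 := hη.ne'
  calc ∑ j, |η⁻¹ * (η * coordMat e (Phi2 η (adCLM ℝ (a (τ x)))) i j - η * coordMat e (Phi2 η (adCLM ℝ (a x))) i j)|
      = ∑ j, |coordMat e (Phi2 η (adCLM ℝ (a (τ x)))) i j - coordMat e (Phi2 η (adCLM ℝ (a (id x)))) i j| :=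
        Finset.sum_congr rfl fun j _ => by rw [← mul_sub, ← mul_assoc, inv_mul_cancel₀ hη0, one_mul]; rfl
    _ ≤ _ := h

omit [Fintype J] [CompleteSpace 𝔄] in
/-- DERIVATIVE FIT OF THE LINEAR SPECIES: `Σ_j |n′(coordMat(ad a′x′) − coordMat(ad b′x′))_{ij} − n(coordMat(ad a(πx′)) − coordMat(ad b(πx′)))_{ij}| ≤ κ_e·2·rθ` from the fit of the
difference QUOTIENTS `‖n′(a′ − b′)(x′) − n(a − b)(πx′)‖ ≤ rθ` (V1a `rowFit_ad_le` on the quotient fields). [folklore] -/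
theorem row_dfit_ad_le (π : X' → X) {n n' r θ : ℝ} {a' b' : X' → 𝔄} {a b : X → 𝔄}
    (hD : ∀ x', ‖n' • (a' x' - b' x') - n • (a (π x') - b (π x'))‖ ≤ r * θ) (x' : X') (i : ι) :
    ∑ j, |n' * (coordMat e (adCLM ℝ (a' x')) i j - coordMat e (adCLM ℝ (b' x')) i j) - n * (coordMat e (adCLM ℝ (a (π x'))) i j - coordMat e (adCLM ℝ (b (π x'))) i j)| ≤
      basisConst e * (2 * (r * θ)) := by
  have h := rowFit_ad_le e π (a' := fun x' => n' • (a' x' - b' x')) (a := fun x => n • (a x - b x)) hD x' i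
  refine le_of_eq_of_le (Finset.sum_congr rfl fun j _ => ?_) h
  have h1 : n' * (coordMat e (adCLM ℝ (a' x')) i j - coordMat e (adCLM ℝ (b' x')) i j) = coordMat e (adCLM ℝ (n' • (a' x' - b' x'))) i j := by
    rw [← smul_coordMat_ad_sub]; simp only [Matrix.smul_apply, Matrix.sub_apply, smul_eq_mul]
  have h2 : n * (coordMat e (adCLM ℝ (a (π x'))) i j - coordMat e (adCLM ℝ (b (π x'))) i j) = coordMat e (adCLM ℝ (n • (a (π x') - b (π x')))) i j := by
    rw [← smul_coordMat_ad_sub]; simp only [Matrix.smul_apply, Matrix.sub_apply, smul_eq_mul]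
  rw [h1, h2]

omit [Fintype J] in
/-- DERIVATIVE FIT OF THE `F′`-PART (`n′η′ = nη = 1`): `(P₂′(a′x′) − P₂′(b′x′)) − (P₂(a(πx′)) − P₂(b(πx′)))` regrouped into two plain fits `≤ κ_e·12e·rθ` (V1a `rowFit_Phi2ad_le` twice).
[folklore] -/
theorem row_dfit_Phi2ad_le (π : X' → X) {r η η' θ : ℝ} (hr : 0 ≤ r) (hr2 : 2 * r ≤ 1) (hη' : 0 ≤ η') (hη'η : η' ≤ η) (hη1 : η ≤ 1) (hηθ : η ≤ θ)
    {a' b' : X' → 𝔄} {a b : X → 𝔄} (ha' : ∀ x', ‖a' x'‖ ≤ r) (hb' : ∀ x', ‖b' x'‖ ≤ r) (ha : ∀ x, ‖a x‖ ≤ r) (hb : ∀ x, ‖b x‖ ≤ r)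
    (hfa : ∀ x', ‖a' x' - a (π x')‖ ≤ r * θ) (hfb : ∀ x', ‖b' x' - b (π x')‖ ≤ r * θ) (x' : X') (i : ι) :
    ∑ j, |(coordMat e (Phi2 η' (adCLM ℝ (a' x'))) i j - coordMat e (Phi2 η' (adCLM ℝ (b' x'))) i j) -
        (coordMat e (Phi2 η (adCLM ℝ (a (π x')))) i j - coordMat e (Phi2 η (adCLM ℝ (b (π x')))) i j)| ≤ basisConst e * (12 * Real.exp 1 * (r * θ)) := by
  have h1 := rowFit_Phi2ad_le e π hr hr2 hη' hη'η hη1 hηθ ha' ha hfa x' i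
  have h2 := rowFit_Phi2ad_le e π hr hr2 hη' hη'η hη1 hηθ hb' hb hfb x' i
  calc _ ≤ ∑ j, (|coordMat e (Phi2 η' (adCLM ℝ (a' x'))) i j - coordMat e (Phi2 η (adCLM ℝ (a (π x')))) i j| +
        |coordMat e (Phi2 η' (adCLM ℝ (b' x'))) i j - coordMat e (Phi2 η (adCLM ℝ (b (π x')))) i j|) := Finset.sum_le_sum fun j _ => by
          rw [show ∀ p q u v : ℝ, (p - q) - (u - v) = (p - u) - (q - v) from fun p q u v => by ring]
          exact abs_sub _ _
    _ ≤ basisConst e * (6 * Real.exp 1 * (r * θ)) + basisConst e * (6 * Real.exp 1 * (r * θ)) := by rw [Finset.sum_add_distrib]; exact add_le_add h1 h2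
    _ = _ := by ring

end Mechanisms

/-! ## §2 The fifteen letters from the letters of the field triples -/

section Triples

variable {X X' J ι : Type} [Fintype J] [Fintype ι] [DecidableEq ι] {𝔄 : Type} [NormedRing 𝔄] [NormedAlgebra ℝ 𝔄] [CompleteSpace 𝔄] (e : 𝔄 ≃L[ℝ] (ι → ℝ))

/-- ★★ **THE FIFTEEN LETTERS OF THE TWO-SIDED BY-PARTS LAYER FOR THE COEFFICIENTS OF `V′₁(A)` FROM THE LETTERS OF THE FIELD TRIPLES.**  Fine triple `U′ = (P′, Q′, W′)` (spacing `η′`,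
shifts `s′`), coarse triple `U = (P, Q, W)` (spacing `η`, shifts `s`), `0 < η′ ≤ η ≤ min(1, θ)`, sups `≤ r` (`2r ≤ 1`), fits `≤ rθ`, one-step letters `‖P_μ − P_μ∘s_μ⁻¹‖, ‖Q_μ − Q_μ∘s_μ⁻¹‖ ≤ rη`
(`rη′` for the fine triple), translated fits of `P_μ∘s_μ⁻¹` and `Q_μ∘s_μ`, derivative fits of the backward quotient of `P_μ` and the forward quotient of `Q_μ` (`≤ rθ`):
`TwoSidedLetters J ι π s s′ η⁻¹ η′⁻¹ (14e(1+|J|)κ_e r) θ (c′, a′) (c, a)`.  Rows and fits by V1a; gradient rows, translated ∕ derivative fits and the coarse oscillation by §1.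
[cite: Balaban1985BackgroundPropagators, (3.35)–(3.36) p.396, (3.52) p.400 (shapes)] -/
theorem twoSidedLetters_of_triples {π : X' → X} {s : J → X ≃ X} {s' : J → X' ≃ X'} {η η' r θ : ℝ} (hη' : 0 < η') (hη'η : η' ≤ η) (hη1 : η ≤ 1) (hηθ : η ≤ θ)
    (hr : 0 ≤ r) (hr2 : 2 * r ≤ 1) {U' : (J → X' → 𝔄) × (J → X' → 𝔄) × (X' → 𝔄)} {U : (J → X → 𝔄) × (J → X → 𝔄) × (X → 𝔄)}
    (hU'₁ : ∀ μ x', ‖U'.1 μ x'‖ ≤ r) (hU'₂ : ∀ μ x', ‖U'.2.1 μ x'‖ ≤ r) (hU'₃ : ∀ x', ‖U'.2.2 x'‖ ≤ r) (hU₁ : ∀ μ x, ‖U.1 μ x‖ ≤ r) (hU₂ : ∀ μ x, ‖U.2.1 μ x‖ ≤ r)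
    (hU₃ : ∀ x, ‖U.2.2 x‖ ≤ r) (hf₁ : ∀ μ x', ‖U'.1 μ x' - U.1 μ (π x')‖ ≤ r * θ) (hf₂ : ∀ μ x', ‖U'.2.1 μ x' - U.2.1 μ (π x')‖ ≤ r * θ)
    (hf₃ : ∀ x', ‖U'.2.2 x' - U.2.2 (π x')‖ ≤ r * θ)
    (hδ'₁ : ∀ μ x', ‖U'.1 μ x' - U'.1 μ ((s' μ).symm x')‖ ≤ r * η') (hδ'₂ : ∀ μ x', ‖U'.2.1 μ x' - U'.2.1 μ ((s' μ).symm x')‖ ≤ r * η')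
    (hδ₁ : ∀ μ x, ‖U.1 μ x - U.1 μ ((s μ).symm x)‖ ≤ r * η) (hδ₂ : ∀ μ x, ‖U.2.1 μ x - U.2.1 μ ((s μ).symm x)‖ ≤ r * η)
    (hT₁ : ∀ μ x', ‖U'.1 μ ((s' μ).symm x') - U.1 μ ((s μ).symm (π x'))‖ ≤ r * θ) (hT₂ : ∀ μ x', ‖U'.2.1 μ (s' μ x') - U.2.1 μ (s μ (π x'))‖ ≤ r * θ)
    (hD₁ : ∀ μ x', ‖η'⁻¹ • (U'.1 μ x' - U'.1 μ ((s' μ).symm x')) - η⁻¹ • (U.1 μ (π x') - U.1 μ ((s μ).symm (π x')))‖ ≤ r * θ)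
    (hD₂ : ∀ μ x', ‖η'⁻¹ • (U'.2.1 μ (s' μ x') - U'.2.1 μ x') - η⁻¹ • (U.2.1 μ (s μ (π x')) - U.2.1 μ (π x'))‖ ≤ r * θ) :
    TwoSidedLetters J ι π s s' η⁻¹ η'⁻¹ (14 * Real.exp 1 * (1 + Fintype.card J) * basisConst e * r) θ (v1coefC e η' U', v1coefA e η' U')
      (v1coefC e η U, v1coefA e η U) := by
  have hκ := basisConst_nonneg e
  have hE : (1 : ℝ) ≤ Real.exp 1 := by have := Real.add_one_le_exp (1 : ℝ); linarith
  have hJ : (0 : ℝ) ≤ Fintype.card J := Nat.cast_nonneg _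
  have hη : 0 < η := lt_of_lt_of_le hη' hη'η
  have hη'1 : η' ≤ 1 := hη'η.trans hη1
  have hθ : 0 ≤ θ := hη.le.trans hηθ
  have hrθ : 0 ≤ r * θ := mul_nonneg hr hθ
  have ht : 0 ≤ Real.exp 1 * basisConst e * r := by positivity
  have htθ : 0 ≤ Real.exp 1 * basisConst e * (r * θ) := by positivity
  -- the two closing inequalities: `C·(eκr) ≤ a` and `C·(eκ·rθ) ≤ aθ` for `C ≤ 14(1+|J|)`
  have hA : ∀ {v C : ℝ}, v ≤ C * (Real.exp 1 * basisConst e * r) → C ≤ 14 * (1 + Fintype.card J) → v ≤ 14 * Real.exp 1 * (1 + Fintype.card J) * basisConst e * r :=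
    fun {v C} hv hC => hv.trans ((mul_le_mul_of_nonneg_right hC ht).trans (le_of_eq (by ring)))
  have hB : ∀ {v C : ℝ}, v ≤ C * (Real.exp 1 * basisConst e * (r * θ)) → C ≤ 14 * (1 + Fintype.card J) →
      v ≤ 14 * Real.exp 1 * (1 + Fintype.card J) * basisConst e * r * θ :=
    fun {v C} hv hC => hv.trans ((mul_le_mul_of_nonneg_right hC htθ).trans (le_of_eq (by ring)))
  -- one-step letters in the forward form and at translated points
  have hδ₁f : ∀ μ x, ‖U.1 μ (s μ x) - U.1 μ x‖ ≤ r * η := fun μ x => by simpa only [Equiv.symm_apply_apply] using hδ₁ μ (s μ x)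
  have hδ'₁f : ∀ μ x', ‖U'.1 μ (s' μ x') - U'.1 μ x'‖ ≤ r * η' := fun μ x' => by simpa only [Equiv.symm_apply_apply] using hδ'₁ μ (s' μ x')
  -- translated triples (for the translated fits 11 ∕ 14)
  have hTr := rowFit_v1coefA e π hr hr2 hη'.le hη'η hη1 hηθ (U' := (fun μ x' => U'.1 μ ((s' μ).symm x'), fun μ x' => U'.2.1 μ (s' μ x'), U'.2.2))
    (U := (fun μ x => U.1 μ ((s μ).symm x), fun μ x => U.2.1 μ (s μ x), U.2.2)) (fun μ x' => hU'₁ μ _) (fun μ x' => hU'₂ μ _) (fun μ x => hU₁ μ _) (fun μ x => hU₂ μ _)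
    hT₁ hT₂
  refine ⟨?_, ?_, ?_, ?_, ?_, ?_, ?_, ?_, ?_, ?_, ?_, ?_, ?_, ?_, ?_⟩
  -- 1–4: rows
  · exact fun x i => hA (C := 4 * (1 + Fintype.card J)) ((rowSum_v1coefC_le e hr hr2 hη.le hη1 hU₁ hU₂ hU₃ x i).trans (le_of_eq (by ring))) (by nlinarith)
  · exact fun μ x i => hA (C := 4) ((rowSum_v1coefA_le e hr hr2 hη.le hη1 hU₁ hU₂ μ x i).trans (le_of_eq (by ring))) (by nlinarith)
  · exact fun x' i => hA (C := 4 * (1 + Fintype.card J)) ((rowSum_v1coefC_le e hr hr2 hη'.le hη'1 hU'₁ hU'₂ hU'₃ x' i).trans (le_of_eq (by ring))) (by nlinarith)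
  · exact fun μ x' i => hA (C := 4) ((rowSum_v1coefA_le e hr hr2 hη'.le hη'1 hU'₁ hU'₂ μ x' i).trans (le_of_eq (by ring))) (by nlinarith)
  -- 5–6: fits
  · exact fun x' i => hB (C := 12 * (1 + Fintype.card J)) ((rowFit_v1coefC e π hr hr2 hη'.le hη'η hη1 hηθ hU'₁ hU'₂ hU₁ hU₂ hf₁ hf₂ hf₃ x' i).trans (le_of_eq (by ring)))
      (by nlinarith)
  · exact fun μ x' i => hB (C := 10) ((rowFit_v1coefA e π hr hr2 hη'.le hη'η hη1 hηθ hU'₁ hU'₂ hU₁ hU₂ hf₁ hf₂ μ x' i).trans (le_of_eq (by ring))) (by nlinarith)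
  -- 7–10: gradient rows (forward coarse ∕ fine, backward coarse ∕ fine)
  · intro μ x i
    have h1 := row_fgrad_ad_le e hη (s μ) (hδ₁ μ) x i
    have h2 := row_fgrad_Phi2ad_le e hη hη1 hr hr2 (s μ) (hU₁ μ) (hδ₁ μ) x i
    refine hA (C := 2 + 6) ?_ (by nlinarith)
    calc ∑ j, |fgradMat η⁻¹ (s μ) (v1coefA e η U (Sum.inl μ)) x i j|
        ≤ ∑ j, (|η⁻¹ * (coordMat e (adCLM ℝ (U.1 μ (s μ x))) i j - coordMat e (adCLM ℝ (U.1 μ x)) i j)| +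
          |η⁻¹ * (η * coordMat e (Phi2 η (adCLM ℝ (U.1 μ (s μ x)))) i j - η * coordMat e (Phi2 η (adCLM ℝ (U.1 μ x))) i j)|) := Finset.sum_le_sum fun j _ => by
            rw [fgradMat_entry, v1coefA_inl, v1coefA_inl]
            simp only [Matrix.add_apply, Matrix.smul_apply, smul_eq_mul]
            rw [show ∀ p q u v : ℝ, η⁻¹ * ((p + q) - (u + v)) = η⁻¹ * (p - u) + η⁻¹ * (q - v) from fun p q u v => by ring]
            exact abs_add_le _ _
      _ ≤ basisConst e * (2 * r) + basisConst e * (6 * Real.exp 1 * (r * η)) := by rw [Finset.sum_add_distrib]; exact add_le_add h1 h2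
      _ ≤ (2 + 6) * (Real.exp 1 * basisConst e * r) := by nlinarith [mul_nonneg hκ hr, mul_le_mul_of_nonneg_left hη1 (mul_nonneg (mul_nonneg (zero_le_one.trans hE) hκ) hr)]
  · intro μ x' i
    have h1 := row_fgrad_ad_le e hη' (s' μ) (hδ'₁ μ) x' i
    have h2 := row_fgrad_Phi2ad_le e hη' hη'1 hr hr2 (s' μ) (hU'₁ μ) (hδ'₁ μ) x' i
    refine hA (C := 2 + 6) ?_ (by nlinarith)
    calc ∑ j, |fgradMat η'⁻¹ (s' μ) (v1coefA e η' U' (Sum.inl μ)) x' i j|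
        ≤ ∑ j, (|η'⁻¹ * (coordMat e (adCLM ℝ (U'.1 μ (s' μ x'))) i j - coordMat e (adCLM ℝ (U'.1 μ x')) i j)| +
          |η'⁻¹ * (η' * coordMat e (Phi2 η' (adCLM ℝ (U'.1 μ (s' μ x')))) i j - η' * coordMat e (Phi2 η' (adCLM ℝ (U'.1 μ x'))) i j)|) := Finset.sum_le_sum fun j _ => by
            rw [fgradMat_entry, v1coefA_inl, v1coefA_inl]
            simp only [Matrix.add_apply, Matrix.smul_apply, smul_eq_mul]
            rw [show ∀ p q u v : ℝ, η'⁻¹ * ((p + q) - (u + v)) = η'⁻¹ * (p - u) + η'⁻¹ * (q - v) from fun p q u v => by ring]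
            exact abs_add_le _ _
      _ ≤ basisConst e * (2 * r) + basisConst e * (6 * Real.exp 1 * (r * η')) := by rw [Finset.sum_add_distrib]; exact add_le_add h1 h2
      _ ≤ (2 + 6) * (Real.exp 1 * basisConst e * r) := by nlinarith [mul_nonneg hκ hr, mul_le_mul_of_nonneg_left hη'1 (mul_nonneg (mul_nonneg (zero_le_one.trans hE) hκ) hr)]
  · intro μ x i
    have h1 := row_fgrad_ad_le e hη (s μ) (hδ₂ μ) x i
    have h2 := row_fgrad_Phi2ad_le e hη hη1 hr hr2 (s μ) (hU₂ μ) (hδ₂ μ) x i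
    refine hA (C := 2 + 6) ?_ (by nlinarith)
    calc ∑ j, |fgradMat η⁻¹ (s μ) (v1coefA e η U (Sum.inr μ)) x i j|
        ≤ ∑ j, (|η⁻¹ * (coordMat e (adCLM ℝ (U.2.1 μ (s μ x))) i j - coordMat e (adCLM ℝ (U.2.1 μ x)) i j)| +
          |η⁻¹ * (η * coordMat e (Phi2 η (adCLM ℝ (U.2.1 μ (s μ x)))) i j - η * coordMat e (Phi2 η (adCLM ℝ (U.2.1 μ x))) i j)|) := Finset.sum_le_sum fun j _ => by
            rw [fgradMat_entry, v1coefA_inr, v1coefA_inr]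
            simp only [Matrix.sub_apply, Matrix.smul_apply, smul_eq_mul]
            rw [show ∀ p q u v : ℝ, η⁻¹ * ((p - q) - (u - v)) = η⁻¹ * (p - u) - η⁻¹ * (q - v) from fun p q u v => by ring]
            exact abs_sub _ _
      _ ≤ basisConst e * (2 * r) + basisConst e * (6 * Real.exp 1 * (r * η)) := by rw [Finset.sum_add_distrib]; exact add_le_add h1 h2
      _ ≤ (2 + 6) * (Real.exp 1 * basisConst e * r) := by nlinarith [mul_nonneg hκ hr, mul_le_mul_of_nonneg_left hη1 (mul_nonneg (mul_nonneg (zero_le_one.trans hE) hκ) hr)]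
  · intro μ x' i
    have h1 := row_fgrad_ad_le e hη' (s' μ) (hδ'₂ μ) x' i
    have h2 := row_fgrad_Phi2ad_le e hη' hη'1 hr hr2 (s' μ) (hU'₂ μ) (hδ'₂ μ) x' i
    refine hA (C := 2 + 6) ?_ (by nlinarith)
    calc ∑ j, |fgradMat η'⁻¹ (s' μ) (v1coefA e η' U' (Sum.inr μ)) x' i j|
        ≤ ∑ j, (|η'⁻¹ * (coordMat e (adCLM ℝ (U'.2.1 μ (s' μ x'))) i j - coordMat e (adCLM ℝ (U'.2.1 μ x')) i j)| +
          |η'⁻¹ * (η' * coordMat e (Phi2 η' (adCLM ℝ (U'.2.1 μ (s' μ x')))) i j - η' * coordMat e (Phi2 η' (adCLM ℝ (U'.2.1 μ x'))) i j)|) := Finset.sum_le_sum fun j _ => by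
            rw [fgradMat_entry, v1coefA_inr, v1coefA_inr]
            simp only [Matrix.sub_apply, Matrix.smul_apply, smul_eq_mul]
            rw [show ∀ p q u v : ℝ, η'⁻¹ * ((p - q) - (u - v)) = η'⁻¹ * (p - u) - η'⁻¹ * (q - v) from fun p q u v => by ring]
            exact abs_sub _ _
      _ ≤ basisConst e * (2 * r) + basisConst e * (6 * Real.exp 1 * (r * η')) := by rw [Finset.sum_add_distrib]; exact add_le_add h1 h2
      _ ≤ (2 + 6) * (Real.exp 1 * basisConst e * r) := by nlinarith [mul_nonneg hκ hr, mul_le_mul_of_nonneg_left hη'1 (mul_nonneg (mul_nonneg (zero_le_one.trans hE) hκ) hr)]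
  -- 11: forward translated fit (V1a on the translated triples, forward component)
  · exact fun μ x' i => hB (C := 10) ((hTr (Sum.inl μ) x' i).trans (le_of_eq (by ring))) (by nlinarith)
  -- 12: translated forward derivative fit
  · intro μ x' i
    have hn' : η'⁻¹ * η' = 1 := inv_mul_cancel₀ hη'.ne'
    have hn : η⁻¹ * η = 1 := inv_mul_cancel₀ hη.ne'
    have h1 := row_dfit_ad_le e π (a' := U'.1 μ) (b' := fun x' => U'.1 μ ((s' μ).symm x')) (a := U.1 μ) (b := fun x => U.1 μ ((s μ).symm x)) (hD₁ μ) x' i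
    have h2 := row_dfit_Phi2ad_le e π hr hr2 hη'.le hη'η hη1 hηθ (a' := U'.1 μ) (b' := fun x' => U'.1 μ ((s' μ).symm x')) (a := U.1 μ)
      (b := fun x => U.1 μ ((s μ).symm x)) (hU'₁ μ) (fun x' => hU'₁ μ _) (hU₁ μ) (fun x => hU₁ μ _) (hf₁ μ) (hT₁ μ) x' i
    refine hB (C := 2 + 12) ?_ (by nlinarith)
    calc ∑ j, |fgradMat η'⁻¹ (s' μ) (v1coefA e η' U' (Sum.inl μ)) ((s' μ).symm x') i j - fgradMat η⁻¹ (s μ) (v1coefA e η U (Sum.inl μ)) ((s μ).symm (π x')) i j|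
        ≤ ∑ j, (|η'⁻¹ * (coordMat e (adCLM ℝ (U'.1 μ x')) i j - coordMat e (adCLM ℝ (U'.1 μ ((s' μ).symm x'))) i j) -
            η⁻¹ * (coordMat e (adCLM ℝ (U.1 μ (π x'))) i j - coordMat e (adCLM ℝ (U.1 μ ((s μ).symm (π x')))) i j)| +
          |(coordMat e (Phi2 η' (adCLM ℝ (U'.1 μ x'))) i j - coordMat e (Phi2 η' (adCLM ℝ (U'.1 μ ((s' μ).symm x')))) i j) -
            (coordMat e (Phi2 η (adCLM ℝ (U.1 μ (π x')))) i j - coordMat e (Phi2 η (adCLM ℝ (U.1 μ ((s μ).symm (π x'))))) i j)|) := Finset.sum_le_sum fun j _ => by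
            rw [fgradMat_entry, fgradMat_entry, v1coefA_inl, v1coefA_inl, v1coefA_inl, v1coefA_inl]
            simp only [Equiv.apply_symm_apply, Matrix.add_apply, Matrix.smul_apply, smul_eq_mul]
            rw [show ∀ m m' p₁ q₁ p₂ q₂ u₁ v₁ u₂ v₂ : ℝ, m' * ((p₁ + η' * q₁) - (p₂ + η' * q₂)) - m * ((u₁ + η * v₁) - (u₂ + η * v₂)) =
              (m' * (p₁ - p₂) - m * (u₁ - u₂)) + ((m' * η') * (q₁ - q₂) - (m * η) * (v₁ - v₂)) from fun _ _ _ _ _ _ _ _ _ _ => by ring, hn', hn, one_mul, one_mul]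
            exact abs_add_le _ _
      _ ≤ basisConst e * (2 * (r * θ)) + basisConst e * (12 * Real.exp 1 * (r * θ)) := by rw [Finset.sum_add_distrib]; exact add_le_add h1 h2
      _ ≤ (2 + 12) * (Real.exp 1 * basisConst e * (r * θ)) := by nlinarith [mul_nonneg hκ hrθ]
  -- 13: coarse one-step oscillation of the forward coefficients
  · intro μ x i
    have hfit : ∀ x, ‖U.1 μ x - U.1 μ ((s μ).symm x)‖ ≤ r * θ := fun x => (hδ₁ μ x).trans (mul_le_mul_of_nonneg_left hηθ hr)
    have h1 := rowFit_ad_le e (fun x => (s μ).symm x) (a' := U.1 μ) (a := U.1 μ) hfit x i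
    have h2 := rowFit_Phi2ad_le e (fun x => (s μ).symm x) hr hr2 hη.le le_rfl hη1 hηθ (a' := U.1 μ) (a := U.1 μ) (hU₁ μ) (hU₁ μ) hfit x i
    refine hB (C := 2 + 6) ?_ (by nlinarith)
    calc ∑ j, |v1coefA e η U (Sum.inl μ) x i j - v1coefA e η U (Sum.inl μ) ((s μ).symm x) i j|
        ≤ ∑ j, (|coordMat e (adCLM ℝ (U.1 μ x)) i j - coordMat e (adCLM ℝ (U.1 μ ((s μ).symm x))) i j| +
          η * |coordMat e (Phi2 η (adCLM ℝ (U.1 μ x))) i j - coordMat e (Phi2 η (adCLM ℝ (U.1 μ ((s μ).symm x)))) i j|) := Finset.sum_le_sum fun j _ => by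
            rw [v1coefA_inl, v1coefA_inl]
            simp only [Matrix.add_apply, Matrix.smul_apply, smul_eq_mul]
            rw [show ∀ p q u v : ℝ, (p + η * q) - (u + η * v) = (p - u) + η * (q - v) from fun p q u v => by ring]
            refine (abs_add_le _ _).trans (le_of_eq ?_)
            rw [abs_mul, abs_of_nonneg hη.le]
      _ ≤ basisConst e * (2 * (r * θ)) + η * (basisConst e * (6 * Real.exp 1 * (r * θ))) := by
          rw [Finset.sum_add_distrib, ← Finset.mul_sum]; exact add_le_add h1 (mul_le_mul_of_nonneg_left h2 hη.le)
      _ ≤ (2 + 6) * (Real.exp 1 * basisConst e * (r * θ)) := by nlinarith [mul_nonneg hκ hrθ, mul_le_mul_of_nonneg_left hη1 (mul_nonneg (mul_nonneg (zero_le_one.trans hE) hκ) hrθ)]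
  -- 14: backward translated fit (V1a on the translated triples, backward component)
  · exact fun μ x' i => hB (C := 10) ((hTr (Sum.inr μ) x' i).trans (le_of_eq (by ring))) (by nlinarith)
  -- 15: untranslated backward derivative fit
  · intro μ x' i
    have hn' : η'⁻¹ * η' = 1 := inv_mul_cancel₀ hη'.ne'
    have hn : η⁻¹ * η = 1 := inv_mul_cancel₀ hη.ne'
    have h1 := row_dfit_ad_le e π (a' := fun x' => U'.2.1 μ (s' μ x')) (b' := U'.2.1 μ) (a := fun x => U.2.1 μ (s μ x)) (b := U.2.1 μ) (hD₂ μ) x' i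
    have h2 := row_dfit_Phi2ad_le e π hr hr2 hη'.le hη'η hη1 hηθ (a' := fun x' => U'.2.1 μ (s' μ x')) (b' := U'.2.1 μ) (a := fun x => U.2.1 μ (s μ x)) (b := U.2.1 μ)
      (fun x' => hU'₂ μ _) (hU'₂ μ) (fun x => hU₂ μ _) (hU₂ μ) (hT₂ μ) (hf₂ μ) x' i
    refine hB (C := 2 + 12) ?_ (by nlinarith)
    calc ∑ j, |fgradMat η'⁻¹ (s' μ) (v1coefA e η' U' (Sum.inr μ)) x' i j - fgradMat η⁻¹ (s μ) (v1coefA e η U (Sum.inr μ)) (π x') i j|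
        ≤ ∑ j, (|η'⁻¹ * (coordMat e (adCLM ℝ (U'.2.1 μ (s' μ x'))) i j - coordMat e (adCLM ℝ (U'.2.1 μ x')) i j) -
            η⁻¹ * (coordMat e (adCLM ℝ (U.2.1 μ (s μ (π x')))) i j - coordMat e (adCLM ℝ (U.2.1 μ (π x'))) i j)| +
          |(coordMat e (Phi2 η' (adCLM ℝ (U'.2.1 μ (s' μ x')))) i j - coordMat e (Phi2 η' (adCLM ℝ (U'.2.1 μ x'))) i j) -
            (coordMat e (Phi2 η (adCLM ℝ (U.2.1 μ (s μ (π x'))))) i j - coordMat e (Phi2 η (adCLM ℝ (U.2.1 μ (π x')))) i j)|) := Finset.sum_le_sum fun j _ => by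
            rw [fgradMat_entry, fgradMat_entry, v1coefA_inr, v1coefA_inr, v1coefA_inr, v1coefA_inr]
            simp only [Matrix.sub_apply, Matrix.smul_apply, smul_eq_mul]
            rw [show ∀ m m' p₁ q₁ p₂ q₂ u₁ v₁ u₂ v₂ : ℝ, m' * ((p₁ - η' * q₁) - (p₂ - η' * q₂)) - m * ((u₁ - η * v₁) - (u₂ - η * v₂)) =
              (m' * (p₁ - p₂) - m * (u₁ - u₂)) - ((m' * η') * (q₁ - q₂) - (m * η) * (v₁ - v₂)) from fun _ _ _ _ _ _ _ _ _ _ => by ring, hn', hn, one_mul, one_mul]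
            exact abs_sub _ _
      _ ≤ basisConst e * (2 * (r * θ)) + basisConst e * (12 * Real.exp 1 * (r * θ)) := by rw [Finset.sum_add_distrib]; exact add_le_add h1 h2
      _ ≤ (2 + 12) * (Real.exp 1 * basisConst e * (r * θ)) := by nlinarith [mul_nonneg hκ hrθ]

end Triples

/-! ## §3 The fifteen letters for the gauge triples of one fine and one coarse gauge field -/

section Gauge

variable {X X' J ι : Type} [Fintype J] [Fintype ι] [DecidableEq ι] {𝔄 : Type} [NormedRing 𝔄] [NormedAlgebra ℝ 𝔄] [CompleteSpace 𝔄] (e : 𝔄 ≃L[ℝ] (ι → ℝ))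

/-- ★★ **THE FIFTEEN LETTERS OF THE TWO-SIDED BY-PARTS LAYER FOR BAŁABAN's SPECIES (3.52) OF ONE FINE AND ONE COARSE GAUGE FIELD.**  For `A′` (spacing `η′`, unit shifts `s′`) and `A`
(spacing `η`, unit shifts `s`; `0 < η′ ≤ η ≤ min(1, θ)`) with the five GAUGE LETTERS at `r` (`2(1+|J|)r ≤ 1`): sups `≤ r`; one-step letters along the own direction `‖A_μ − A_μ∘s_μ⁻¹‖ ≤ rη`
(`rη′`); fit `‖A′_μ − A_μ∘π‖ ≤ rθ`; translated fit `‖A′_μ∘s′_μ⁻¹ − A_μ∘s_μ⁻¹∘π‖ ≤ rθ`; derivative fit `‖η′⁻¹(A′_μ − A′_μ∘s′_μ⁻¹) − η⁻¹(A_μ − A_μ∘s_μ⁻¹)∘π‖ ≤ rθ` — the coefficient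
configurations `(c′, a′)`, `(c, a)` of the gauge triples `v1fieldsOfGauge s′ η′ A′ = (A′, A′∘s′⁻¹, ∇′*A′)`, `v1fieldsOfGauge s η A` (V1b) obey
`TwoSidedLetters J ι π s s′ η⁻¹ η′⁻¹ (14e(1+|J|)²κ_e r) θ`.  (§2 at `r̂ = (1+|J|)r`: the divergence `W = Σ_μ η⁻¹(A_μ − A_μ∘s_μ⁻¹)` has sup `≤ |J|r` and fit `≤ |J|rθ` by the one-step and
derivative letters; the backward components are the translates.) [cite: Balaban1985BackgroundPropagators, (3.35)–(3.36) p.396, (3.52) p.400 (shapes)] -/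
theorem twoSidedLetters_of_gauge {π : X' → X} {s : J → X ≃ X} {s' : J → X' ≃ X'} {η η' r θ : ℝ} (hη' : 0 < η') (hη'η : η' ≤ η) (hη1 : η ≤ 1) (hηθ : η ≤ θ)
    (hr : 0 ≤ r) (hr2 : 2 * ((1 + Fintype.card J) * r) ≤ 1) {A' : J → X' → 𝔄} {A : J → X → 𝔄} (hs' : ∀ μ x', ‖A' μ x'‖ ≤ r) (hs : ∀ μ x, ‖A μ x‖ ≤ r)
    (hd' : ∀ μ x', ‖A' μ x' - A' μ ((s' μ).symm x')‖ ≤ r * η') (hd : ∀ μ x, ‖A μ x - A μ ((s μ).symm x)‖ ≤ r * η) (hf : ∀ μ x', ‖A' μ x' - A μ (π x')‖ ≤ r * θ)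
    (hfT : ∀ μ x', ‖A' μ ((s' μ).symm x') - A μ ((s μ).symm (π x'))‖ ≤ r * θ)
    (hfD : ∀ μ x', ‖η'⁻¹ • (A' μ x' - A' μ ((s' μ).symm x')) - η⁻¹ • (A μ (π x') - A μ ((s μ).symm (π x')))‖ ≤ r * θ) :
    TwoSidedLetters J ι π s s' η⁻¹ η'⁻¹ (14 * Real.exp 1 * (1 + Fintype.card J) * basisConst e * ((1 + Fintype.card J) * r)) θ
      (v1coefC e η' (v1fieldsOfGauge 𝔄 J s' η' A'), v1coefA e η' (v1fieldsOfGauge 𝔄 J s' η' A'))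
      (v1coefC e η (v1fieldsOfGauge 𝔄 J s η A), v1coefA e η (v1fieldsOfGauge 𝔄 J s η A)) := by
  set R : ℝ := (1 + Fintype.card J) * r with hR
  have hJ : (0 : ℝ) ≤ Fintype.card J := Nat.cast_nonneg _
  have hrR : r ≤ R := by rw [hR]; nlinarith
  have hJR : Fintype.card J * r ≤ R := by rw [hR]; nlinarith
  have hR0 : 0 ≤ R := hr.trans hrR
  have hη : 0 < η := lt_of_lt_of_le hη' hη'η
  have hθ : 0 ≤ θ := hη.le.trans hηθ
  have hRθ : r * θ ≤ R * θ := mul_le_mul_of_nonneg_right hrR hθ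
  -- the divergence: sup `≤ |J|r`, fit `≤ |J|rθ`
  have hW : ∀ {Y : Type} (t : J → Y ≃ Y) {ζ : ℝ} (hζ : 0 < ζ) {B : J → Y → 𝔄} (hB : ∀ μ y, ‖B μ y - B μ ((t μ).symm y)‖ ≤ r * ζ) (y : Y),
      ‖∑ μ, ζ⁻¹ • (B μ y - B μ ((t μ).symm y))‖ ≤ R := by
    intro Y t ζ hζ B hB y
    calc ‖∑ μ, ζ⁻¹ • (B μ y - B μ ((t μ).symm y))‖ ≤ ∑ μ, ‖ζ⁻¹ • (B μ y - B μ ((t μ).symm y))‖ := norm_sum_le _ _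
      _ ≤ ∑ _μ : J, r := Finset.sum_le_sum fun μ _ => by
          rw [norm_smul, Real.norm_eq_abs, abs_of_nonneg (inv_nonneg.mpr hζ.le)]
          calc ζ⁻¹ * ‖B μ y - B μ ((t μ).symm y)‖ ≤ ζ⁻¹ * (r * ζ) := mul_le_mul_of_nonneg_left (hB μ y) (inv_nonneg.mpr hζ.le)
            _ = r := by field_simp
      _ = Fintype.card J * r := by rw [Finset.sum_const, Finset.card_univ, nsmul_eq_mul]
      _ ≤ R := hJR
  have hWf : ∀ x', ‖(∑ μ, η'⁻¹ • (A' μ x' - A' μ ((s' μ).symm x'))) - ∑ μ, η⁻¹ • (A μ (π x') - A μ ((s μ).symm (π x')))‖ ≤ R * θ := fun x' => by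
    rw [← Finset.sum_sub_distrib]
    calc _ ≤ ∑ μ, ‖η'⁻¹ • (A' μ x' - A' μ ((s' μ).symm x')) - η⁻¹ • (A μ (π x') - A μ ((s μ).symm (π x')))‖ := norm_sum_le _ _
      _ ≤ ∑ _μ : J, r * θ := Finset.sum_le_sum fun μ _ => hfD μ x'
      _ = Fintype.card J * (r * θ) := by rw [Finset.sum_const, Finset.card_univ, nsmul_eq_mul]
      _ ≤ R * θ := by nlinarith [mul_le_mul_of_nonneg_right hJR hθ]
  exact twoSidedLetters_of_triples e hη' hη'η hη1 hηθ hR0 hr2 (U' := v1fieldsOfGauge 𝔄 J s' η' A') (U := v1fieldsOfGauge 𝔄 J s η A)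
    (fun μ x' => (hs' μ x').trans hrR) (fun μ x' => (hs' μ _).trans hrR) (hW s' hη' hd') (fun μ x => (hs μ x).trans hrR) (fun μ x => (hs μ _).trans hrR) (hW s hη hd)
    (fun μ x' => (hf μ x').trans hRθ) (fun μ x' => (hfT μ x').trans hRθ) hWf (fun μ x' => (hd' μ x').trans (mul_le_mul_of_nonneg_right hrR hη'.le))
    (fun μ x' => (hd' μ _).trans (mul_le_mul_of_nonneg_right hrR hη'.le)) (fun μ x => (hd μ x).trans (mul_le_mul_of_nonneg_right hrR hη.le))
    (fun μ x => (hd μ _).trans (mul_le_mul_of_nonneg_right hrR hη.le)) (fun μ x' => (hfT μ x').trans hRθ)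
    (fun μ x' => by simpa only [v1fieldsOfGauge, Equiv.symm_apply_apply] using (hf μ x').trans hRθ) (fun μ x' => (hfD μ x').trans hRθ)
    (fun μ x' => by simpa only [v1fieldsOfGauge, Equiv.symm_apply_apply] using (hfD μ x').trans hRθ)

end Gauge

end Summit.QuantumFields.YangMills.BalabanUVNodes.N15.BackgroundLayer

end
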